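import Summits.HodgeConjecture.HodgeConjecture.Cruxes.BlochSeedDiscOne.RingFourEmpty
import Summits.HodgeConjecture.HodgeConjecture.Cruxes.BlochSeedDiscOne.HeightTower

/-!
# RingTwoEffEmpty — RING 1 is empty under `RuleD ∧ Disj`; RING 2 is empty under `RuleD ∧ Disj ∧ (A1)` plus EFFECTIVE Hall-out —
# no budget, no rank, no margin; at every height (plan-lens-HodgeAV-strengthen g16, STRENGTHEN-MEMO-25; lens «strengthen»)

Token: line stmt-HodgeConjecture-18881 Cruxes/BlochSeedDiscOne/Lines/birth.lean 814a6a70c14e831a stub_rung_pad4_seedAt.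

LETTER-MODEL BOOKKEEPING ONLY (`DepthBoundA4.Design`; ring `c` = all supported letters of co-level `|x| + |y| ≤ c`; at height `14` ring 2 is the
thirteen letters `(14;0,0)`, `(13;±1,0)∕(13;0,±1)`, `(12;±2,0)∕(12;0,±2)`, `(12;±1,±1)`).  Nothing here is a sheaf, a display or a SEED and nothing
is proved toward HC ∕ HC_CM ∕ HC_AV ∕ №4 ∕ 26512 ∕ 18881 ∕ H2.  `Nonex 14 199 8` stays REFUTED as typed (`RotatedPairB136`).

CONTEXT.  Director-hodge R19.621, statement of record v4.1: `OnAlphabet h ∧ Disj ∧ (A1) ∧ RuleD ∧ HallEff ∧ PortHall₈ ∧ μ ≠ 0 ∧ budget ⇒ ⊥`.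
plan-lens-HodgeAV-anomaly g14 (bus l.12378) exhibited an explicit ring-2 design with `OnAlphabet 14 ∧ Disj ∧ (A1) ∧ RuleD ∧ μ ≠ 0` (copies 13 106),
and s4-search-1 g35 (l.12402, ×2 idea-crit-hsem-4 g10) showed that `+854·hub⁴` repairs Hall OVER WEAK ARROWS (`DepthBoundA4.WeakLive`,
`HallB136.HallUp`: equal, or `a < a′ ∧ |Δβ|² ≤ Δa²` on every factor — NULL steps count).  So over WEAK arrows every budget-free clause of v4.1 is
jointly inhabited on ring 2 and the BUDGET is load-bearing there.  THIS FILE decides the budget-free question on the other side of the one remaining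
dial, the arrow notion, and below ring 2:

* RING 1 (§8, §9): `OnAlphabet h ∧ Ring1 ∧ Disj ∧ RuleD ⇒ μ = 0` — NO (A1), NO Hall, NO budget (anomaly g14 (Q2), ×3 by pen on the bus; kernel here).
* RING 2 with EFFECTIVE out-arrows (§7, §9): `OnAlphabet h ∧ Ring2 ∧ Disj ∧ RuleD ∧ EffOut ∧ (A1) ⇒ μ = 0`, where `EffOut` = «every supported
  P-cell has an arrow to some supported N-cell that is, on every factor, EQUAL or AMPLY above (`|Δβ|² < Δa²`)» — the `Hom ≠ 0` pattern for atoms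
  GENERIC in their algebraic-equivalence classes (STRENGTHEN-MEMO-23 §7).  `EffOut` is STRICTLY STRONGER than the weak Hall of record, and the
  theorem is FALSE with `WeakLive` in its place (the padded inhabitant above).  Reading: without the budget, v4.1 on ring 2 dies iff NULL arrows
  are excluded; equivalently every budget-free ring-2 inhabitant matches its diagonal-free P-mass through NULL arrows only (`hasDiag_of_effOut`:
  under `Disj` a P-cell with an effective arrow to an N-cell carries a diagonal floor letter `(h−2;±1,±1)`).

THE FINITE LETTER CALCULUS (the lens's «S⁺ step», here for the ring index `c = 1, 2`):
* §1–§2  the thirteen ring-2 letters (`mem_R2`) and their finite facts (`decide`): levels `∈ {12,13,14}`; `a = 14 ⟺ β = 0`; an AMPLE step inside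
  the ring is exactly «diagonal floor → hub» (`R2_ample`); a NULL step never lands on a floor letter.
* §3  LAW F = the anatomy of a `RuleD ∧ Disj` room on ring 2 (pen = anomaly g14's greatest-fixed-point digits N 1 041 ∕ P 5 009, = s4-search-1
  g35's «sound gfp pruning» (F1)–(F3); kernel here, h-uniform by §9): (F1) no supported N-cell has two floor slots; (F2) a supported P-cell with
  two floor slots is HUB on the other two; (F3) a supported N-cell with a floor slot and a level-`(h−1)` slot is HUB on the other two.
* §4  `EffOut ∧ Disj ⇒` every supported P-cell carries a DIAGONAL floor letter.
* §5–§6  classes `H X A D` (hub ∕ level 13 ∕ axis floor ∕ diagonal floor), class data `(a, a² − |β|²) = (14,196), (13,168), (12,140), (12,142)`;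
  the anatomy in counts; ONE e-free functional `G = Gcell γ₀`, `γ₀ = (0, −186592, 26852, 13328, −2884, 69)` in `RingFourEmpty`'s ρ-basis (this
  seat's exact LP `eng/ring2cert.py`), with `G ≥ [fully charged]` on N-anatomy class tuples and `−G ≥ [fully charged]` on P-anatomy class tuples
  (`decide`; in fact `G = 2352` on `X⁴`, `−2352` on `D·X³`, `−392` on `D·H·X²`, `0` on every other anatomy type).
* §7  (A1) kills `G` (`RingFourEmpty.G_vanishes`), so no supported cell is fully charged (`no_full`), `μ = 0`, `ring2_vacuous`.
* §8  RING 1: a `RuleD ∧ Disj` room on ring 1 has no fully charged cell (two lines), `ring1_mu_eq_zero`.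
* §9  ALL HEIGHTS by the shift `a ↦ a + (14 − h)` (`HeightTower`: `a1_shiftD`, `mu_shiftD`, `onAlphabet_shift`, `colevel_shift`; the shift
  invariance of `NullStep ∕ Supplies ∕ Detects ∕ RuleD ∕ Disj ∕ EffOut` is proved here): `ring1_mu_eq_zero_allHeights`, `ring2_vacuous_allHeights`.

§0 carries VERBATIM copies of the `LeggedFloor` predicates `FullBelow ∕ NullStep ∕ Supplies ∕ Detects ∕ RuleDP ∕ RuleD ∕ Disj` and of its two
`μ`-vanishing lemmas (that module, committed 2026-08-30, is not yet served by the farm; the bridges `LeggedFloor.RuleD D ↔ RuleD D` etc. are `Iff.rfl`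
for a successor).  Imports `RingFourEmpty` (the functional `Gcell`, `G_vanishes`, `linZ` bookkeeping) and `HeightTower` (shifts).
No `axiom` ∕ `instance` ∕ `sorry` ∕ `native_decide` ∕ `unsafe`; finite checks are closed `Bool`s evaluated by `decide`; `#print axioms ring2_vacuous` =
`propext, Classical.choice, Quot.sound`.
-/

set_option linter.dupNamespace false
set_option autoImplicit false
set_option maxRecDepth 8192
set_option maxHeartbeats 4000000

namespace Summit.HodgeConjecture.HodgeConjecture.Cruxes.BlochSeedDiscOne.RingTwoEffEmpty

open Summit.HodgeConjecture.HodgeConjecture.Cruxes.BlochSeedDiscOne.DepthBoundA4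
open Summit.HodgeConjecture.HodgeConjecture.Cruxes.BlochSeedDiscOne.RingFourEmpty
open Summit.HodgeConjecture.HodgeConjecture.Cruxes.BlochSeedDiscOne.HeightTower

/-! ## §0 The `LeggedFloor` interface (verbatim copies; bridges are `Iff.rfl`) -/

/-- All four legs of the cell have level `< h` (on the height-`h` alphabet: all four legs are charged, `β ≠ 0`). [= `LeggedFloor.FullBelow`] -/
def FullBelow (h : ℤ) (c : Cell) : Prop := ∀ f : Fin 4, (c f).a < h

/-- NULL step on one factor: `a < a′` and `|β′ − β|² = (a′ − a)²`. [= `LeggedFloor.NullStep`] -/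
def NullStep (ℓ ℓ' : Letter) : Prop :=
  ℓ.a < ℓ'.a ∧ (ℓ'.x - ℓ.x) ^ 2 + (ℓ'.y - ℓ.y) ^ 2 = (ℓ'.a - ℓ.a) ^ 2

/-- `x` (a P-cell) and `y` (an N-cell) form a SUPPLIER PAIR for the block `(g, j)`: equal off `{g, j}`, and on each of
`g`, `j` either EQUAL or a NULL step. [= `LeggedFloor.Supplies`] -/
def Supplies (x y : Cell) (g j : Fin 4) : Prop :=
  (∀ f : Fin 4, f ≠ g → f ≠ j → x f = y f) ∧
    (x g = y g ∨ NullStep (x g) (y g)) ∧ (x j = y j ∨ NullStep (x j) (y j))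

/-- The `(g, j)` block of `ob_κ(c)` is nonzero for some `κ ∈ T_W`: NOT (`β_g = β_j = 0` and `a_g = a_j`). [= `LeggedFloor.Detects`] -/
def Detects (c : Cell) (g j : Fin 4) : Prop :=
  ¬ ((c g).x = 0 ∧ (c g).y = 0 ∧ (c j).x = 0 ∧ (c j).y = 0 ∧ (c g).a = (c j).a)

/-- RULE D, P-side clause: every detecting block of every supported P-cell is supplied by some supported N-cell. [= `LeggedFloor.RuleDP`] -/
def RuleDP (D : Design) : Prop :=
  ∀ x ∈ D.suppP, ∀ g j : Fin 4, g < j → Detects x g j → ∃ y ∈ D.suppN, Supplies x y g j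

/-- RULE D (both sides), same text as memo-152. [= `LeggedFloor.RuleD`] -/
def RuleD (D : Design) : Prop :=
  (∀ y ∈ D.suppN, ∀ g j : Fin 4, g < j → Detects y g j → ∃ x ∈ D.suppP, Supplies x y g j) ∧ RuleDP D

/-- Disjoint supports (a minimal two-term display: no cell occurs on both sides). [= `LeggedFloor.Disj`] -/
def Disj (D : Design) : Prop := ∀ c : Cell, c ∈ D.suppN → c ∈ D.suppP → False

theorem mem_supp_of_memP (D : Design) {x : Cell} (hx : x ∈ D.suppP) : x ∈ D.suppN ++ D.suppP :=
  List.mem_append_right _ hx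

theorem mem_supp_of_memN (D : Design) {y : Cell} (hy : y ∈ D.suppN) : y ∈ D.suppN ++ D.suppP :=
  List.mem_append_left _ hy

/-- on the alphabet, a letter of level `≥ h` is the hub letter. [= `LeggedFloor.xy_eq_zero_of_not_lt`] -/
theorem xy_eq_zero_of_not_lt {h : ℤ} {ℓ : Letter} (hℓ : ℓ.OnAlphabet h) (hn : ¬ ℓ.a < h) : ℓ.x = 0 ∧ ℓ.y = 0 := by
  have h1 := hℓ.1
  unfold Letter.height at h1
  have hx := abs_nonneg ℓ.x
  have hy := abs_nonneg ℓ.y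
  have hx0 : |ℓ.x| = 0 := by linarith
  have hy0 : |ℓ.y| = 0 := by linarith
  exact ⟨abs_eq_zero.mp hx0, abs_eq_zero.mp hy0⟩

/-- A cell on the alphabet that is not fully charged has a hub leg, hence zero Bloch coefficient. [= `LeggedFloor.cellCoef_eeee_eq_zero_of_not_full`] -/
theorem cellCoef_eeee_eq_zero_of_not_full {h : ℤ} {c : Cell} (hc : ∀ f : Fin 4, (c f).OnAlphabet h)
    (hn : ¬ FullBelow h c) : cellCoef c Word.eeee = 0 := by
  unfold FullBelow at hn
  obtain ⟨f, hf⟩ := not_forall.mp hn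
  have hxy := xy_eq_zero_of_not_lt (hc f) hf
  have hb : (c f).beta = 0 := by
    ext <;> simp [Letter.beta, hxy.1, hxy.2]
  rw [cellCoef]
  apply Finset.prod_eq_zero (Finset.mem_univ f)
  simp [Word.eeee, Sym.coef, hb]

/-- [= `LeggedFloor.listSum_eeee_eq_zero`] -/
theorem listSum_eeee_eq_zero (L : List (Cell × ℕ))
    (hL : ∀ cm ∈ L, 0 < cm.2 → cellCoef cm.1 Word.eeee = 0) :
    (L.map fun cm => (cm.2 : GaussianInt) * cellCoef cm.1 Word.eeee).sum = 0 := by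
  apply List.sum_eq_zero
  intro t ht
  rw [List.mem_map] at ht
  obtain ⟨cm, hcm, rfl⟩ := ht
  by_cases h0 : 0 < cm.2
  · rw [hL cm hcm h0, mul_zero]
  · have : cm.2 = 0 := by omega
    rw [this]; simp

/-! ## §1 The thirteen ring-2 letters -/

/-- The letters of the height-14 alphabet of co-level `≤ 2`. -/
def R2 : List Letter :=
  [⟨14, 0, 0⟩, ⟨13, 1, 0⟩, ⟨13, -1, 0⟩, ⟨13, 0, 1⟩, ⟨13, 0, -1⟩,
   ⟨12, 2, 0⟩, ⟨12, -2, 0⟩, ⟨12, 0, 2⟩, ⟨12, 0, -2⟩, ⟨12, 1, 1⟩, ⟨12, 1, -1⟩, ⟨12, -1, 1⟩, ⟨12, -1, -1⟩]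

theorem mem_R2 {ℓ : Letter} (hℓ : ℓ.OnAlphabet 14) (hc : ℓ.colevel ≤ 2) : ℓ ∈ R2 := by
  obtain ⟨a, x, y⟩ := ℓ
  have h1 := hℓ.1
  simp only [Letter.height, Letter.colevel] at h1 hc
  have hx := abs_nonneg x
  have hy := abs_nonneg y
  have hxb : -2 ≤ x ∧ x ≤ 2 := abs_le.mp (by linarith)
  have hyb : -2 ≤ y ∧ y ≤ 2 := abs_le.mp (by linarith)
  obtain rfl : a = 14 - |x| - |y| := by linarith
  obtain ⟨hx1, hx2⟩ := hxb
  obtain ⟨hy1, hy2⟩ := hyb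
  interval_cases x <;> interval_cases y <;> first | decide | (norm_num at hc)

/-- RING 2: every letter of every supported cell has co-level `≤ 2`. -/
def Ring2 (D : Design) : Prop := ∀ c ∈ D.suppN ++ D.suppP, ∀ f : Fin 4, (c f).colevel ≤ 2

theorem memR2_of_supp {D : Design} (hD : D.OnAlphabet 14) (hR : Ring2 D) {c : Cell} (hc : c ∈ D.suppN ++ D.suppP)
    (f : Fin 4) : c f ∈ R2 :=
  mem_R2 (hD c hc f) (hR c hc f)

/-! ## §2 Finite letter facts (`decide` over `R2`) -/

/-- `Bool` mirror of `AmpleAbove`. -/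
def ampleB (ℓ ℓ' : Letter) : Bool :=
  decide (ℓ.a < ℓ'.a) && decide ((ℓ'.x - ℓ.x) ^ 2 + (ℓ'.y - ℓ.y) ^ 2 < (ℓ'.a - ℓ.a) ^ 2)

theorem ampleB_of_ampleAbove {ℓ ℓ' : Letter} (h : AmpleAbove ℓ ℓ') : ampleB ℓ ℓ' = true := by
  unfold AmpleAbove at h
  simp [ampleB, h.1, h.2]

/-- levels of ring-2 letters, and `a = 14 ⟺ β = 0`. -/
theorem R2_levels : ∀ ℓ ∈ R2, 12 ≤ ℓ.a ∧ ℓ.a ≤ 14 ∧ (ℓ.a = 14 ↔ ℓ.x = 0 ∧ ℓ.y = 0) := by decide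

/-- THE AMPLE STEPS INSIDE RING 2: only «diagonal floor → hub». -/
theorem R2_ample : ∀ ℓ ∈ R2, ∀ ℓ' ∈ R2, ampleB ℓ ℓ' = true → ℓ.a = 12 ∧ ℓ.bnorm = 2 ∧ ℓ'.a = 14 := by decide

theorem level_ge_12 {ℓ : Letter} (h : ℓ ∈ R2) : 12 ≤ ℓ.a := (R2_levels ℓ h).1

theorem level_le_14 {ℓ : Letter} (h : ℓ ∈ R2) : ℓ.a ≤ 14 := (R2_levels ℓ h).2.1

theorem level_eq_14_iff {ℓ : Letter} (h : ℓ ∈ R2) : ℓ.a = 14 ↔ ℓ.x = 0 ∧ ℓ.y = 0 := (R2_levels ℓ h).2.2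

/-- a NULL step never lands on a floor letter. -/
theorem not_null_to_floor {ℓ ℓ' : Letter} (h : ℓ ∈ R2) (hn : NullStep ℓ ℓ') (h12 : ℓ'.a = 12) : False := by
  have := hn.1
  have := level_ge_12 h
  omega

/-- a NULL step landing on a level-13 letter starts on a floor letter. -/
theorem null_to_13 {ℓ ℓ' : Letter} (h : ℓ ∈ R2) (hn : NullStep ℓ ℓ') (h13 : ℓ'.a = 13) : ℓ.a = 12 := by
  have := hn.1
  have := level_ge_12 h
  omega

/-- a charged slot (level `< 14`, i.e. `≠ 14` in the ring) makes every block through it DETECTING. -/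
theorem detects_of_ne_14 {c : Cell} {g : Fin 4} (hg : c g ∈ R2) (hne : (c g).a ≠ 14) (j : Fin 4) : Detects c g j := by
  intro h
  exact hne ((level_eq_14_iff hg).mpr ⟨h.1, h.2.1⟩)

/-- a non-detecting block is hub–hub. -/
theorem levels_of_not_detects {c : Cell} {g j : Fin 4} (hg : c g ∈ R2) (hj : c j ∈ R2) (h : ¬ Detects c g j) :
    (c g).a = 14 ∧ (c j).a = 14 := by
  have h' := not_not.mp h
  exact ⟨(level_eq_14_iff hg).mpr ⟨h'.1, h'.2.1⟩, (level_eq_14_iff hj).mpr ⟨h'.2.2.1, h'.2.2.2.1⟩⟩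

/-! ## §3 LAW F — the anatomy of a `RuleD ∧ Disj` room on ring 2 -/

theorem supplies_symm {x y : Cell} {g j : Fin 4} (h : Supplies x y g j) : Supplies x y j g :=
  ⟨fun f hfj hfg => h.1 f hfg hfj, h.2.2, h.2.1⟩

theorem detects_symm {c : Cell} {g j : Fin 4} (h : Detects c g j) : Detects c j g := by
  intro hc
  exact h ⟨hc.2.2.1, hc.2.2.2.1, hc.1, hc.2.1, hc.2.2.2.2.symm⟩

/-- RULE D, N-side, for an unordered block. -/
theorem supplier_of_N {D : Design} (hrule : RuleD D) {y : Cell} (hy : y ∈ D.suppN) {g j : Fin 4} (hgj : g ≠ j)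
    (hdet : Detects y g j) : ∃ x ∈ D.suppP, Supplies x y g j := by
  rcases lt_or_gt_of_ne hgj with h | h
  · exact hrule.1 y hy g j h hdet
  · obtain ⟨x, hx, hs⟩ := hrule.1 y hy j g h (detects_symm hdet)
    exact ⟨x, hx, supplies_symm hs⟩

/-- RULE D, P-side, for an unordered block. -/
theorem witness_of_P {D : Design} (hrule : RuleD D) {x : Cell} (hx : x ∈ D.suppP) {g j : Fin 4} (hgj : g ≠ j)
    (hdet : Detects x g j) : ∃ y ∈ D.suppN, Supplies x y g j := by
  rcases lt_or_gt_of_ne hgj with h | h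
  · exact hrule.2 x hx g j h hdet
  · obtain ⟨y, hy, hs⟩ := hrule.2 x hx j g h (detects_symm hdet)
    exact ⟨y, hy, supplies_symm hs⟩

/-- two cells equal off a block and on the block are equal. -/
theorem cell_eq_of_supplies {x y : Cell} {g j : Fin 4} (hs : Supplies x y g j) (hg : x g = y g) (hj : x j = y j) :
    x = y := by
  funext f
  by_cases hfg : f = g
  · rw [hfg]; exact hg
  by_cases hfj : f = j
  · rw [hfj]; exact hj
  exact hs.1 f hfg hfj

theorem exists_fourth (a b c : Fin 4) : ∃ v : Fin 4, v ≠ a ∧ v ≠ b ∧ v ≠ c := by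
  revert a b c
  decide

/-- **(F1)** no supported N-cell has two floor slots (its supplier would be the cell itself). -/
theorem F1 {D : Design} (hD : D.OnAlphabet 14) (hR : Ring2 D) (hdisj : Disj D) (hrule : RuleD D)
    {y : Cell} (hy : y ∈ D.suppN) {g j : Fin 4} (hgj : g ≠ j) (hg : (y g).a = 12) (hj : (y j).a = 12) : False := by
  have hyS := mem_supp_of_memN D hy
  have hdet : Detects y g j := detects_of_ne_14 (memR2_of_supp hD hR hyS g) (by omega) j
  obtain ⟨x, hx, hsup⟩ := supplier_of_N hrule hy hgj hdet
  have hxS := mem_supp_of_memP D hx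
  have exg : x g = y g := by
    rcases hsup.2.1 with h | h
    · exact h
    · exact (not_null_to_floor (memR2_of_supp hD hR hxS g) h hg).elim
  have exj : x j = y j := by
    rcases hsup.2.2 with h | h
    · exact h
    · exact (not_null_to_floor (memR2_of_supp hD hR hxS j) h hj).elim
  have hxy : x = y := cell_eq_of_supplies hsup exg exj
  exact hdisj y hy (hxy ▸ hx)

/-- **(F2)** a supported P-cell with two floor slots is HUB on every other slot (else the witness of the complementary block
carries the two floors, contradicting (F1)). -/
theorem F2 {D : Design} (hD : D.OnAlphabet 14) (hR : Ring2 D) (hdisj : Disj D) (hrule : RuleD D)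
    {x : Cell} (hx : x ∈ D.suppP) {f1 f2 : Fin 4} (h12 : f1 ≠ f2) (hf1 : (x f1).a = 12) (hf2 : (x f2).a = 12)
    (u : Fin 4) (hu1 : u ≠ f1) (hu2 : u ≠ f2) : (x u).a = 14 := by
  have hxS := mem_supp_of_memP D hx
  obtain ⟨v, hv1, hv2, hvu⟩ := exists_fourth f1 f2 u
  suffices hnd : ¬ Detects x u v from
    (levels_of_not_detects (memR2_of_supp hD hR hxS u) (memR2_of_supp hD hR hxS v) hnd).1
  intro hdet
  obtain ⟨y, hy, hsup⟩ := witness_of_P hrule hx (Ne.symm hvu) hdet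
  have e1 : x f1 = y f1 := hsup.1 f1 (Ne.symm hu1) (Ne.symm hv1)
  have e2 : x f2 = y f2 := hsup.1 f2 (Ne.symm hu2) (Ne.symm hv2)
  exact F1 hD hR hdisj hrule hy h12 (by rw [← e1]; exact hf1) (by rw [← e2]; exact hf2)

/-- **(F3)** a supported N-cell with a floor slot and a level-13 slot is HUB on the other two (its supplier for that block is a
P-cell with two floors; apply (F2)). -/
theorem F3 {D : Design} (hD : D.OnAlphabet 14) (hR : Ring2 D) (hdisj : Disj D) (hrule : RuleD D)
    {y : Cell} (hy : y ∈ D.suppN) {f s : Fin 4} (hfs : f ≠ s) (hf : (y f).a = 12) (hs : (y s).a = 13)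
    (u : Fin 4) (huf : u ≠ f) (hus : u ≠ s) : (y u).a = 14 := by
  have hyS := mem_supp_of_memN D hy
  have hdet : Detects y f s := detects_of_ne_14 (memR2_of_supp hD hR hyS f) (by omega) s
  obtain ⟨x, hx, hsup⟩ := supplier_of_N hrule hy hfs hdet
  have hxS := mem_supp_of_memP D hx
  have exf : x f = y f := by
    rcases hsup.2.1 with h | h
    · exact h
    · exact (not_null_to_floor (memR2_of_supp hD hR hxS f) h hf).elim
  rcases hsup.2.2 with h | h
  · -- equal on the whole block: `x = y`, contradicting disjointness
    exact (hdisj y hy ((cell_eq_of_supplies hsup exf h) ▸ hx)).elim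
  · -- a null step into the level-13 slot: the supplier has the two floors `f`, `s`
    have hxs : (x s).a = 12 := null_to_13 (memR2_of_supp hD hR hxS s) h hs
    have hxf : (x f).a = 12 := by rw [exf]; exact hf
    rw [← hsup.1 u huf hus]
    exact F2 hD hR hdisj hrule hx hfs hxf hxs u huf hus

/-! ## §4 Effective arrows: `EffOut ∧ Disj ⇒` every supported P-cell carries a diagonal floor letter -/

/-- EFFECTIVE arrow `x → y` (STRENGTHEN-MEMO-23 §7: the `Hom ≠ 0` pattern for atoms GENERIC in their classes): on every factor EQUAL or AMPLY
ABOVE.  STRICTLY STRONGER than `DepthBoundA4.WeakLive` (which also admits NULL steps `|Δβ|² = Δa²`), the arrow notion of `HallB136.HallUp`. -/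
def EffArrow (x y : Cell) : Prop := ∀ f : Fin 4, x f = y f ∨ AmpleAbove (x f) (y f)

/-- EFFECTIVE HALL-OUT: every supported P-cell has an effective arrow to some supported N-cell (Hall over effective arrows at singletons;
NOT implied by the weak Hall of record — `anomaly g14 + 854·hub⁴` satisfies `HallUp` and violates `EffOut`). -/
def EffOut (D : Design) : Prop := ∀ x ∈ D.suppP, ∃ y ∈ D.suppN, EffArrow x y

/-- Under `EffOut ∧ Disj` on ring 2 every supported P-cell has a DIAGONAL floor slot `(12;±1,±1)`. -/
theorem hasDiag_of_effOut {D : Design} (hD : D.OnAlphabet 14) (hR : Ring2 D) (hdisj : Disj D) (hout : EffOut D)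
    {x : Cell} (hx : x ∈ D.suppP) : ∃ f : Fin 4, (x f).a = 12 ∧ (x f).bnorm = 2 := by
  obtain ⟨y, hy, harr⟩ := hout x hx
  by_contra hno
  have hxS := mem_supp_of_memP D hx
  have hyS := mem_supp_of_memN D hy
  have hxy : x = y := by
    funext f
    rcases harr f with h | h
    · exact h
    · have hamp := R2_ample (x f) (memR2_of_supp hD hR hxS f) (y f) (memR2_of_supp hD hR hyS f) (ampleB_of_ampleAbove h)
      exact (hno ⟨f, hamp.1, hamp.2.1⟩).elim
  exact hdisj y hy (hxy ▸ hx)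

/-! ## §5 Letter classes and the anatomy in counts -/

/-- letter classes on ring 2: hub, level 13, axis floor, diagonal floor. -/
inductive LC where
  | H | X | A | D
  deriving DecidableEq, Repr, Fintype

namespace LC

/-- level `a` -/
def av : LC → ℤ
  | H => 14 | X => 13 | A => 12 | D => 12

/-- `n = a² − |β|²` -/
def nv : LC → ℤ
  | H => 196 | X => 168 | A => 140 | D => 142

/-- floor classes -/
def fl : LC → Bool
  | A => true | D => true | _ => false

/-- the hub class -/
def isH : LC → Bool
  | H => true | _ => false

/-- the diagonal class -/
def isD : LC → Bool
  | D => true | _ => false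

end LC

/-- the class of a letter (meaningful on `R2`). -/
def classOf (ℓ : Letter) : LC :=
  if ℓ.a = 14 then LC.H else if ℓ.a = 13 then LC.X else if ℓ.bnorm = 4 then LC.A else LC.D

/-- class data = letter data on `R2`. -/
theorem R2_class : ∀ ℓ ∈ R2, ℓ.a = (classOf ℓ).av ∧ ℓ.selfInt = (classOf ℓ).nv ∧
    ((classOf ℓ).fl = true ↔ ℓ.a = 12) ∧ ((classOf ℓ).isH = true ↔ ℓ.a = 14) ∧ (classOf ℓ = LC.X ↔ ℓ.a = 13) ∧
    ((classOf ℓ).isD = true ↔ ℓ.a = 12 ∧ ℓ.bnorm = 2) := by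
  decide

theorem fl_iff {ℓ : Letter} (h : ℓ ∈ R2) : (classOf ℓ).fl = true ↔ ℓ.a = 12 := (R2_class ℓ h).2.2.1
theorem isH_iff {ℓ : Letter} (h : ℓ ∈ R2) : (classOf ℓ).isH = true ↔ ℓ.a = 14 := (R2_class ℓ h).2.2.2.1
theorem X_iff {ℓ : Letter} (h : ℓ ∈ R2) : classOf ℓ = LC.X ↔ ℓ.a = 13 := (R2_class ℓ h).2.2.2.2.1
theorem isD_iff {ℓ : Letter} (h : ℓ ∈ R2) : (classOf ℓ).isD = true ↔ ℓ.a = 12 ∧ ℓ.bnorm = 2 := (R2_class ℓ h).2.2.2.2.2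

/-- `∀` over `LC` as a `Bool`. -/
def allLC (p : LC → Bool) : Bool := p LC.H && p LC.X && p LC.A && p LC.D

theorem allLC_spec (p : LC → Bool) (h : allLC p = true) (k : LC) : p k = true := by
  cases k <;> simp_all [allLC]

/-- number of floor slots -/
def cntF (k0 k1 k2 k3 : LC) : ℕ := k0.fl.toNat + k1.fl.toNat + k2.fl.toNat + k3.fl.toNat
/-- number of hub slots -/
def cntH (k0 k1 k2 k3 : LC) : ℕ := k0.isH.toNat + k1.isH.toNat + k2.isH.toNat + k3.isH.toNat
/-- number of diagonal slots -/
def cntD (k0 k1 k2 k3 : LC) : ℕ := k0.isD.toNat + k1.isD.toNat + k2.isD.toNat + k3.isD.toNat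

/-- N-anatomy in counts: `#floor ≤ 1`, and `#floor = 1 → #H ≥ 2`. -/
abbrev NAnat (k0 k1 k2 k3 : LC) : Prop := cntF k0 k1 k2 k3 ≤ 1 ∧ (cntF k0 k1 k2 k3 = 1 → 2 ≤ cntH k0 k1 k2 k3)

/-- P-anatomy in counts (with the Hall-out diagonal): `#floor ≤ 2`, `#floor = 2 → #H = 2`, `#D ≥ 1`. -/
abbrev PAnat (k0 k1 k2 k3 : LC) : Prop :=
  cntF k0 k1 k2 k3 ≤ 2 ∧ (cntF k0 k1 k2 k3 = 2 → cntH k0 k1 k2 k3 = 2) ∧ 1 ≤ cntD k0 k1 k2 k3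

/-- fully charged = no hub slot. -/
abbrev FullC (k0 k1 k2 k3 : LC) : Prop := cntH k0 k1 k2 k3 = 0

/-- (F1) on a class vector: no two floor slots. -/
def LawF1 (k : Fin 4 → LC) : Prop := ∀ g j : Fin 4, g ≠ j → (k g).fl = true → (k j).fl = true → False

/-- (F3) on a class vector: a floor slot and an `X` slot force hubs elsewhere. -/
def LawF3 (k : Fin 4 → LC) : Prop :=
  ∀ f s u : Fin 4, f ≠ s → u ≠ f → u ≠ s → (k f).fl = true → k s = LC.X → (k u).isH = true

/-- (F2) on a class vector: two floor slots force hubs elsewhere. -/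
def LawF2 (k : Fin 4 → LC) : Prop :=
  ∀ f1 f2 u : Fin 4, f1 ≠ f2 → u ≠ f1 → u ≠ f2 → (k f1).fl = true → (k f2).fl = true → (k u).isH = true

/-- a diagonal slot -/
def HasDiag (k : Fin 4 → LC) : Prop := ∃ f : Fin 4, (k f).isD = true

/-- no hub slot -/
def NoHub (k : Fin 4 → LC) : Prop := ∀ f : Fin 4, (k f).isH = false

/-- `Bool` mirrors (keeps the `decide` instances small). -/
def lawF1B (k : Fin 4 → LC) : Bool :=
  (List.finRange 4).all fun g => (List.finRange 4).all fun j => !(decide (g ≠ j) && (k g).fl && (k j).fl)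

def lawF3B (k : Fin 4 → LC) : Bool :=
  (List.finRange 4).all fun f => (List.finRange 4).all fun s => (List.finRange 4).all fun u =>
    !(decide (f ≠ s) && decide (u ≠ f) && decide (u ≠ s) && (k f).fl && decide (k s = LC.X)) || (k u).isH

def lawF2B (k : Fin 4 → LC) : Bool :=
  (List.finRange 4).all fun f1 => (List.finRange 4).all fun f2 => (List.finRange 4).all fun u =>
    !(decide (f1 ≠ f2) && decide (u ≠ f1) && decide (u ≠ f2) && (k f1).fl && (k f2).fl) || (k u).isH

def hasDiagB (k : Fin 4 → LC) : Bool := (List.finRange 4).any fun f => (k f).isD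

def noHubB (k : Fin 4 → LC) : Bool := (List.finRange 4).all fun f => !(k f).isH

theorem lawF1B_of {k : Fin 4 → LC} (h : LawF1 k) : lawF1B k = true := by
  unfold lawF1B
  simp only [List.all_eq_true, List.mem_finRange, true_implies]
  intro g j
  have := h g j
  revert this
  cases (k g).fl <;> cases (k j).fl <;> by_cases hgj : g = j <;> simp [hgj]

theorem lawF3B_of {k : Fin 4 → LC} (h : LawF3 k) : lawF3B k = true := by
  unfold lawF3B
  simp only [List.all_eq_true, List.mem_finRange, true_implies]
  intro f s u
  have := h f s u
  revert this
  cases (k f).fl <;> cases (k u).isH <;> by_cases hfs : f = s <;> by_cases huf : u = f <;> by_cases hus : u = s <;>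
    by_cases hX : k s = LC.X <;> simp [hfs, huf, hus, hX]

theorem lawF2B_of {k : Fin 4 → LC} (h : LawF2 k) : lawF2B k = true := by
  unfold lawF2B
  simp only [List.all_eq_true, List.mem_finRange, true_implies]
  intro f1 f2 u
  have := h f1 f2 u
  revert this
  cases (k f1).fl <;> cases (k f2).fl <;> cases (k u).isH <;> by_cases h12 : f1 = f2 <;> by_cases hu1 : u = f1 <;>
    by_cases hu2 : u = f2 <;> simp [h12, hu1, hu2]

theorem hasDiagB_of {k : Fin 4 → LC} (h : HasDiag k) : hasDiagB k = true := by
  unfold hasDiagB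
  obtain ⟨f, hf⟩ := h
  exact List.any_eq_true.mpr ⟨f, List.mem_finRange f, hf⟩

theorem noHubB_of {k : Fin 4 → LC} (h : NoHub k) : noHubB k = true := by
  unfold noHubB
  simp only [List.all_eq_true, List.mem_finRange, true_implies]
  intro f
  simp [h f]

/-- from the pairwise laws (F1), (F3) to the N counts (finite check over `4⁴` class tuples). -/
theorem nanat_of_pairwise (k0 k1 k2 k3 : LC) (h1 : lawF1B ![k0, k1, k2, k3] = true) (h3 : lawF3B ![k0, k1, k2, k3] = true) :
    NAnat k0 k1 k2 k3 := by
  revert k0 k1 k2 k3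
  decide

/-- from the pairwise law (F2) and the diagonal to the P counts. -/
theorem panat_of_pairwise (k0 k1 k2 k3 : LC) (h2 : lawF2B ![k0, k1, k2, k3] = true) (hd : hasDiagB ![k0, k1, k2, k3] = true) :
    PAnat k0 k1 k2 k3 := by
  revert k0 k1 k2 k3
  decide

theorem fullC_of (k0 k1 k2 k3 : LC) (h : noHubB ![k0, k1, k2, k3] = true) : FullC k0 k1 k2 k3 := by
  revert k0 k1 k2 k3
  decide

/-! ## §6 The certificate -/

/-- `G` on a class tuple. -/
def GP (γ : Coefs) (k0 k1 k2 k3 : LC) : ℤ := Gpoly γ k0.av k0.nv k1.av k1.nv k2.av k2.nv k3.av k3.nv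

/-- THE MULTIPLIERS (exact LP `eng/ring2cert.py`, strengthen g16). -/
def γ₀ : Coefs := ⟨0, -186592, 26852, 13328, -2884, 69⟩

/-- N-side check: `G ≥ 0`, and `G ≥ 1` on fully charged tuples, over the N-anatomy. -/
def chkN (γ : Coefs) : Bool :=
  allLC fun k0 => allLC fun k1 => allLC fun k2 => allLC fun k3 =>
    decide (NAnat k0 k1 k2 k3 → 0 ≤ GP γ k0 k1 k2 k3 ∧ (FullC k0 k1 k2 k3 → 1 ≤ GP γ k0 k1 k2 k3))

/-- P-side check: `G ≤ 0`, and `G ≤ −1` on fully charged tuples, over the P-anatomy. -/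
def chkP (γ : Coefs) : Bool :=
  allLC fun k0 => allLC fun k1 => allLC fun k2 => allLC fun k3 =>
    decide (PAnat k0 k1 k2 k3 → GP γ k0 k1 k2 k3 ≤ 0 ∧ (FullC k0 k1 k2 k3 → GP γ k0 k1 k2 k3 ≤ -1))

theorem chkN_ok : chkN γ₀ = true := by decide

theorem chkP_ok : chkP γ₀ = true := by decide

theorem chkN_spec (k0 k1 k2 k3 : LC) (hk : NAnat k0 k1 k2 k3) :
    0 ≤ GP γ₀ k0 k1 k2 k3 ∧ (FullC k0 k1 k2 k3 → 1 ≤ GP γ₀ k0 k1 k2 k3) :=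
  of_decide_eq_true (allLC_spec _ (allLC_spec _ (allLC_spec _ (allLC_spec _ chkN_ok k0) k1) k2) k3) hk

theorem chkP_spec (k0 k1 k2 k3 : LC) (hk : PAnat k0 k1 k2 k3) :
    GP γ₀ k0 k1 k2 k3 ≤ 0 ∧ (FullC k0 k1 k2 k3 → GP γ₀ k0 k1 k2 k3 ≤ -1) :=
  of_decide_eq_true (allLC_spec _ (allLC_spec _ (allLC_spec _ (allLC_spec _ chkP_ok k0) k1) k2) k3) hk

/-! ## §7 Assembly: no fully charged cell, `μ = 0`, vacuity -/

/-- the class tuple of a cell -/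
def K (c : Cell) : Fin 4 → LC := fun f => classOf (c f)

theorem K_vec (c : Cell) : (![K c 0, K c 1, K c 2, K c 3] : Fin 4 → LC) = K c := by
  funext f
  fin_cases f <;> rfl

theorem Gcell_eq_GP (γ : Coefs) {c : Cell} (hc : ∀ f : Fin 4, c f ∈ R2) :
    Gcell γ c = GP γ (K c 0) (K c 1) (K c 2) (K c 3) := by
  have e := fun f => (R2_class (c f) (hc f)).1
  have n := fun f => (R2_class (c f) (hc f)).2.1
  show Gpoly γ (c 0).a (c 0).selfInt (c 1).a (c 1).selfInt (c 2).a (c 2).selfInt (c 3).a (c 3).selfInt =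
    Gpoly γ (classOf (c 0)).av (classOf (c 0)).nv (classOf (c 1)).av (classOf (c 1)).nv
      (classOf (c 2)).av (classOf (c 2)).nv (classOf (c 3)).av (classOf (c 3)).nv
  rw [e 0, n 0, e 1, n 1, e 2, n 2, e 3, n 3]

theorem nanat_of_suppN {D : Design} (hD : D.OnAlphabet 14) (hR : Ring2 D) (hdisj : Disj D) (hrule : RuleD D)
    {y : Cell} (hy : y ∈ D.suppN) : NAnat (K y 0) (K y 1) (K y 2) (K y 3) := by
  have hyS := mem_supp_of_memN D hy
  have hm := fun f => memR2_of_supp hD hR hyS f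
  apply nanat_of_pairwise
  · rw [K_vec]
    apply lawF1B_of
    intro g j hgj hg hj
    exact F1 hD hR hdisj hrule hy hgj ((fl_iff (hm g)).mp hg) ((fl_iff (hm j)).mp hj)
  · rw [K_vec]
    apply lawF3B_of
    intro f s u hfs huf hus hf hs
    exact (isH_iff (hm u)).mpr (F3 hD hR hdisj hrule hy hfs ((fl_iff (hm f)).mp hf) ((X_iff (hm s)).mp hs) u huf hus)

theorem panat_of_suppP {D : Design} (hD : D.OnAlphabet 14) (hR : Ring2 D) (hdisj : Disj D) (hrule : RuleD D)
    (hout : EffOut D) {x : Cell} (hx : x ∈ D.suppP) : PAnat (K x 0) (K x 1) (K x 2) (K x 3) := by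
  have hxS := mem_supp_of_memP D hx
  have hm := fun f => memR2_of_supp hD hR hxS f
  apply panat_of_pairwise
  · rw [K_vec]
    apply lawF2B_of
    intro f1 f2 u h12 hu1 hu2 hf1 hf2
    exact (isH_iff (hm u)).mpr (F2 hD hR hdisj hrule hx h12 ((fl_iff (hm f1)).mp hf1) ((fl_iff (hm f2)).mp hf2) u hu1 hu2)
  · rw [K_vec]
    apply hasDiagB_of
    obtain ⟨f, hf⟩ := hasDiag_of_effOut hD hR hdisj hout hx
    exact ⟨f, (isD_iff (hm f)).mpr hf⟩

theorem fullC_of_fullBelow {D : Design} (hD : D.OnAlphabet 14) (hR : Ring2 D) {c : Cell} (hc : c ∈ D.suppN ++ D.suppP)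
    (hfull : FullBelow 14 c) : FullC (K c 0) (K c 1) (K c 2) (K c 3) := by
  apply fullC_of
  rw [K_vec]
  apply noHubB_of
  intro f
  have hm := memR2_of_supp hD hR hc f
  cases h : (K c f).isH with
  | false => rfl
  | true => exact absurd ((isH_iff hm).mp h) (ne_of_lt (hfull f))

/-- the indicator of «fully charged», as a class function -/
def fullInd (c : Cell) : ℤ := if FullC (K c 0) (K c 1) (K c 2) (K c 3) then 1 else 0

theorem fullInd_nonneg (c : Cell) : 0 ≤ fullInd c := by
  unfold fullInd
  split <;> norm_num

/-- **NO FULLY CHARGED CELL** under `Ring2 ∧ Disj ∧ RuleD ∧ EffOut ∧ (A1)`. -/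
theorem no_full {D : Design} (hD : D.OnAlphabet 14) (hR : Ring2 D) (hdisj : Disj D) (hrule : RuleD D) (hout : EffOut D)
    (h1 : D.A1) : ∀ c ∈ D.suppN ++ D.suppP, ¬ FullBelow 14 c := by
  -- N side: `[full] ≤ G`; P side: `[full] ≤ −G`, cell by cell
  have hN : linZ D.N fullInd ≤ linZ D.N (Gcell γ₀) := by
    apply linZ_mono
    intro cm hcm hpos
    have hmem : cm.1 ∈ D.suppN := List.mem_map.mpr ⟨cm, List.mem_filter.mpr ⟨hcm, by simpa using hpos⟩, rfl⟩
    have hc := fun f => memR2_of_supp hD hR (mem_supp_of_memN D hmem) f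
    have hk := chkN_spec _ _ _ _ (nanat_of_suppN hD hR hdisj hrule hmem)
    rw [Gcell_eq_GP γ₀ hc]
    by_cases hF : FullC (K cm.1 0) (K cm.1 1) (K cm.1 2) (K cm.1 3)
    · rw [show fullInd cm.1 = 1 from if_pos hF]; exact hk.2 hF
    · rw [show fullInd cm.1 = 0 from if_neg hF]; exact hk.1
  have hP : linZ D.P fullInd ≤ linZ D.P (fun c => (-1) * Gcell γ₀ c) := by
    apply linZ_mono
    intro cm hcm hpos
    have hmem : cm.1 ∈ D.suppP := List.mem_map.mpr ⟨cm, List.mem_filter.mpr ⟨hcm, by simpa using hpos⟩, rfl⟩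
    have hc := fun f => memR2_of_supp hD hR (mem_supp_of_memP D hmem) f
    have hk := chkP_spec _ _ _ _ (panat_of_suppP hD hR hdisj hrule hout hmem)
    show fullInd cm.1 ≤ (-1) * Gcell γ₀ cm.1
    rw [Gcell_eq_GP γ₀ hc]
    by_cases hF : FullC (K cm.1 0) (K cm.1 1) (K cm.1 2) (K cm.1 3)
    · rw [show fullInd cm.1 = 1 from if_pos hF]; have := hk.2 hF; linarith
    · rw [show fullInd cm.1 = 0 from if_neg hF]; have := hk.1; linarith
  rw [linZ_smul] at hP
  have hv := G_vanishes D h1 γ₀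
  have h0N : 0 ≤ linZ D.N fullInd := linZ_nonneg _ _ fun cm _ _ => fullInd_nonneg cm.1
  have h0P : 0 ≤ linZ D.P fullInd := linZ_nonneg _ _ fun cm _ _ => fullInd_nonneg cm.1
  have zN : linZ D.N fullInd = 0 := by linarith
  have zP : linZ D.P fullInd = 0 := by linarith
  intro c hc hfull
  have hind : fullInd c = 1 := if_pos (fullC_of_fullBelow hD hR hc hfull)
  rcases List.mem_append.mp hc with hcN | hcP
  · obtain ⟨cm, hcm, rfl⟩ := List.mem_map.mp hcN
    obtain ⟨hmem, hpos⟩ := List.mem_filter.mp hcm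
    have ht := term_le_linZ D.N fullInd fullInd_nonneg cm.1 cm.2 (by simpa using hmem)
    rw [hind, zN] at ht
    simp at hpos
    have : (1 : ℤ) ≤ cm.2 := by exact_mod_cast hpos
    linarith
  · obtain ⟨cm, hcm, rfl⟩ := List.mem_map.mp hcP
    obtain ⟨hmem, hpos⟩ := List.mem_filter.mp hcm
    have ht := term_le_linZ D.P fullInd fullInd_nonneg cm.1 cm.2 (by simpa using hmem)
    rw [hind, zP] at ht
    simp at hpos
    have : (1 : ℤ) ≤ cm.2 := by exact_mod_cast hpos
    linarith

/-- `μ = 0` from «no fully charged cell» (termwise vanishing of the Bloch coefficient `∏ β̄`). -/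
theorem mu_eq_zero_of_no_full {D : Design} (hD : D.OnAlphabet 14) (hnf : ∀ c ∈ D.suppN ++ D.suppP, ¬ FullBelow 14 c) :
    D.mu = 0 := by
  have hN : (D.N.map fun cm => (cm.2 : GaussianInt) * cellCoef cm.1 Word.eeee).sum = 0 := by
    apply listSum_eeee_eq_zero
    intro cm hcm h0
    have hmem : cm.1 ∈ D.suppN := List.mem_map.mpr ⟨cm, List.mem_filter.mpr ⟨hcm, by simpa using h0⟩, rfl⟩
    have hsupp := mem_supp_of_memN D hmem
    exact cellCoef_eeee_eq_zero_of_not_full (hD cm.1 hsupp) (hnf cm.1 hsupp)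
  have hP : (D.P.map fun cm => (cm.2 : GaussianInt) * cellCoef cm.1 Word.eeee).sum = 0 := by
    apply listSum_eeee_eq_zero
    intro cm hcm h0
    have hmem : cm.1 ∈ D.suppP := List.mem_map.mpr ⟨cm, List.mem_filter.mpr ⟨hcm, by simpa using h0⟩, rfl⟩
    have hsupp := mem_supp_of_memP D hmem
    exact cellCoef_eeee_eq_zero_of_not_full (hD cm.1 hsupp) (hnf cm.1 hsupp)
  show D.T Word.eeee = 0
  rw [Design.T, hN, hP, sub_zero]

/-- **`μ = 0` ON RING 2** under `Disj ∧ RuleD ∧ EffOut ∧ (A1)` — no budget, no rank, no Hall margin. -/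
theorem mu_eq_zero {D : Design} (hD : D.OnAlphabet 14) (hR : Ring2 D) (hdisj : Disj D) (hrule : RuleD D) (hout : EffOut D)
    (h1 : D.A1) : D.mu = 0 :=
  mu_eq_zero_of_no_full hD (no_full hD hR hdisj hrule hout h1)

/-- **VACUITY OF v4.1 ON RING 2 WITHOUT BUDGET OR MARGIN**: `OnAlphabet 14`, `Ring2`, `Disj`, `RuleD`, `EffOut`, `(A1)`, `μ ≠ 0`
are jointly unsatisfiable. -/
theorem ring2_vacuous {D : Design} (hD : D.OnAlphabet 14) (hR : Ring2 D) (hdisj : Disj D) (hrule : RuleD D) (hout : EffOut D)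
    (h1 : D.A1) (hμ : D.mu ≠ 0) : False :=
  hμ (mu_eq_zero hD hR hdisj hrule hout h1)

/-! ## §8 RING 1 is empty under `RuleD ∧ Disj` alone (anomaly g14 (Q2); first kernel version) -/

/-- RING 1: every supported letter has co-level `≤ 1`. -/
def Ring1 (D : Design) : Prop := ∀ c ∈ D.suppN ++ D.suppP, ∀ f : Fin 4, (c f).colevel ≤ 1

theorem ring2_of_ring1 {D : Design} (h : Ring1 D) : Ring2 D := fun c hc f => le_trans (h c hc f) (by norm_num)

theorem level_ge_13_of_ring1 {D : Design} (hD : D.OnAlphabet 14) (h1 : Ring1 D) {c : Cell} (hc : c ∈ D.suppN ++ D.suppP)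
    (f : Fin 4) : 13 ≤ (c f).a := by
  have hh := (hD c hc f).1
  have hc1 := h1 c hc f
  unfold Letter.height at hh
  unfold Letter.colevel at hc1
  omega

/-- on ring 1 no supported N-cell has two charged (level-13) slots. -/
theorem ring1_N {D : Design} (hD : D.OnAlphabet 14) (h1R : Ring1 D) (hdisj : Disj D) (hrule : RuleD D)
    {y : Cell} (hy : y ∈ D.suppN) {g j : Fin 4} (hgj : g ≠ j) (hg : (y g).a = 13) (hj : (y j).a = 13) : False := by
  have hR := ring2_of_ring1 h1R
  have hyS := mem_supp_of_memN D hy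
  have hdet : Detects y g j := detects_of_ne_14 (memR2_of_supp hD hR hyS g) (by omega) j
  obtain ⟨x, hx, hsup⟩ := supplier_of_N hrule hy hgj hdet
  have hxS := mem_supp_of_memP D hx
  have exg : x g = y g := by
    rcases hsup.2.1 with h | h
    · exact h
    · have := h.1; have := level_ge_13_of_ring1 hD h1R hxS g; omega
  have exj : x j = y j := by
    rcases hsup.2.2 with h | h
    · exact h
    · have := h.1; have := level_ge_13_of_ring1 hD h1R hxS j; omega
  exact hdisj y hy ((cell_eq_of_supplies hsup exg exj) ▸ hx)

/-- on ring 1 no supported cell is fully charged. -/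
theorem ring1_no_full {D : Design} (hD : D.OnAlphabet 14) (h1R : Ring1 D) (hdisj : Disj D) (hrule : RuleD D) :
    ∀ c ∈ D.suppN ++ D.suppP, ¬ FullBelow 14 c := by
  intro c hc hfull
  have hR := ring2_of_ring1 h1R
  have h13 : ∀ f : Fin 4, (c f).a = 13 := fun f => by
    have := hfull f; have := level_ge_13_of_ring1 hD h1R hc f; omega
  rcases List.mem_append.mp hc with hcN | hcP
  · exact ring1_N hD h1R hdisj hrule hcN (show (0 : Fin 4) ≠ 1 by decide) (h13 0) (h13 1)
  · -- a fully charged P-cell: the witness of block `(0,1)` agrees with it on slots `2, 3`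
    have hdet : Detects c 0 1 := detects_of_ne_14 (memR2_of_supp hD hR hc 0) (by have := h13 0; omega) 1
    obtain ⟨y, hy, hsup⟩ := witness_of_P hrule hcP (show (0 : Fin 4) ≠ 1 by decide) hdet
    have e2 : c 2 = y 2 := hsup.1 2 (by decide) (by decide)
    have e3 : c 3 = y 3 := hsup.1 3 (by decide) (by decide)
    exact ring1_N hD h1R hdisj hrule hy (show (2 : Fin 4) ≠ 3 by decide) (by rw [← e2]; exact h13 2) (by rw [← e3]; exact h13 3)

/-- **RING 1: `RuleD ∧ Disj ⇒ μ = 0`** (no (A1), no Hall, no budget, no rank). -/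
theorem ring1_mu_eq_zero {D : Design} (hD : D.OnAlphabet 14) (h1R : Ring1 D) (hdisj : Disj D) (hrule : RuleD D) :
    D.mu = 0 :=
  mu_eq_zero_of_no_full hD (ring1_no_full hD h1R hdisj hrule)

/-! ## §9 All heights, by the shift `a ↦ a + (14 − h)` -/

theorem shiftL_injective (t : ℤ) : Function.Injective (shiftL t) := by
  intro ℓ ℓ' h
  cases ℓ with
  | mk a x y =>
    cases ℓ' with
    | mk a' x' y' =>
      simp only [shiftL, Letter.mk.injEq] at h ⊢
      omega

theorem shiftCell_injective (t : ℤ) : Function.Injective (shiftCell t) := by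
  intro c c' h
  funext g
  have hg := congrFun h g
  simp only [shiftCell] at hg
  exact shiftL_injective t hg

theorem nullStep_shiftL (t : ℤ) (ℓ ℓ' : Letter) : NullStep (shiftL t ℓ) (shiftL t ℓ') ↔ NullStep ℓ ℓ' := by
  simp only [NullStep, shiftL_a, shiftL_x, shiftL_y, add_lt_add_iff_right, add_sub_add_right_eq_sub]

theorem detects_shift (t : ℤ) (c : Cell) (g j : Fin 4) : Detects (shiftCell t c) g j ↔ Detects c g j := by
  simp only [Detects, shiftCell, shiftL_a, shiftL_x, shiftL_y, add_left_inj]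

theorem supplies_shift (t : ℤ) (x y : Cell) (g j : Fin 4) :
    Supplies (shiftCell t x) (shiftCell t y) g j ↔ Supplies x y g j := by
  simp only [Supplies, shiftCell, nullStep_shiftL, (shiftL_injective t).eq_iff]

theorem effArrow_shift (t : ℤ) (x y : Cell) : EffArrow (shiftCell t x) (shiftCell t y) ↔ EffArrow x y := by
  simp only [EffArrow, shiftCell, ampleAbove_shiftL, (shiftL_injective t).eq_iff]

theorem ruleD_shift (t : ℤ) {D : Design} (hr : RuleD D) : RuleD (shiftD t D) := by
  constructor
  · intro y hy g j hgj hdet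
    rw [suppN_shift] at hy
    obtain ⟨y₀, hy₀, rfl⟩ := List.mem_map.mp hy
    obtain ⟨x₀, hx₀, hs⟩ := hr.1 y₀ hy₀ g j hgj ((detects_shift t y₀ g j).mp hdet)
    exact ⟨shiftCell t x₀, by rw [suppP_shift]; exact List.mem_map.mpr ⟨x₀, hx₀, rfl⟩, (supplies_shift t x₀ y₀ g j).mpr hs⟩
  · intro x hx g j hgj hdet
    rw [suppP_shift] at hx
    obtain ⟨x₀, hx₀, rfl⟩ := List.mem_map.mp hx
    obtain ⟨y₀, hy₀, hs⟩ := hr.2 x₀ hx₀ g j hgj ((detects_shift t x₀ g j).mp hdet)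
    exact ⟨shiftCell t y₀, by rw [suppN_shift]; exact List.mem_map.mpr ⟨y₀, hy₀, rfl⟩, (supplies_shift t x₀ y₀ g j).mpr hs⟩

theorem disj_shift (t : ℤ) {D : Design} (hd : Disj D) : Disj (shiftD t D) := by
  intro c hcN hcP
  rw [suppN_shift] at hcN
  rw [suppP_shift] at hcP
  obtain ⟨c₁, h₁, rfl⟩ := List.mem_map.mp hcN
  obtain ⟨c₂, h₂, he⟩ := List.mem_map.mp hcP
  rw [shiftCell_injective t he] at h₂
  exact hd c₁ h₁ h₂

theorem effOut_shift (t : ℤ) {D : Design} (ho : EffOut D) : EffOut (shiftD t D) := by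
  intro x hx
  rw [suppP_shift] at hx
  obtain ⟨x₀, hx₀, rfl⟩ := List.mem_map.mp hx
  obtain ⟨y₀, hy₀, harr⟩ := ho x₀ hx₀
  exact ⟨shiftCell t y₀, by rw [suppN_shift]; exact List.mem_map.mpr ⟨y₀, hy₀, rfl⟩, (effArrow_shift t x₀ y₀).mpr harr⟩

theorem ring2_shift (t : ℤ) {D : Design} (hR : Ring2 D) : Ring2 (shiftD t D) := colevel_shift D t 2 hR

theorem ring1_shift (t : ℤ) {D : Design} (hR : Ring1 D) : Ring1 (shiftD t D) := colevel_shift D t 1 hR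

/-- a design on the height-`h` alphabet whose letters have co-level `≤ 2` shifts to the height-`14` alphabet. -/
theorem onAlphabet14_of_shift {h : ℤ} {D : Design} (hD : D.OnAlphabet h) (hR : Ring2 D) : (shiftD (14 - h) D).OnAlphabet 14 := by
  have ha : ∀ c ∈ D.suppN ++ D.suppP, ∀ f : Fin 4, 0 ≤ (c f).a + (14 - h) := by
    intro c hc f
    have h1 := (hD c hc f).1
    have h2 := hR c hc f
    unfold Letter.height at h1
    unfold Letter.colevel at h2
    linarith
  have hA := onAlphabet_shift D h (14 - h) hD ha
  rwa [show h + (14 - h) = 14 by ring] at hA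

/-- **RING 1 AT EVERY HEIGHT: `RuleD ∧ Disj ⇒ μ = 0`.** -/
theorem ring1_mu_eq_zero_allHeights {h : ℤ} {D : Design} (hD : D.OnAlphabet h) (h1R : Ring1 D) (hdisj : Disj D)
    (hrule : RuleD D) : D.mu = 0 := by
  rw [← mu_shiftD (14 - h) D]
  exact ring1_mu_eq_zero (onAlphabet14_of_shift hD (ring2_of_ring1 h1R)) (ring1_shift _ h1R) (disj_shift _ hdisj)
    (ruleD_shift _ hrule)

/-- **RING 2 AT EVERY HEIGHT: `Disj ∧ RuleD ∧ EffOut ∧ (A1) ⇒ μ = 0`** (no budget, no rank, no margin). -/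
theorem ring2_mu_eq_zero_allHeights {h : ℤ} {D : Design} (hD : D.OnAlphabet h) (hR : Ring2 D) (hdisj : Disj D) (hrule : RuleD D)
    (hout : EffOut D) (h1 : D.A1) : D.mu = 0 := by
  rw [← mu_shiftD (14 - h) D]
  exact mu_eq_zero (onAlphabet14_of_shift hD hR) (ring2_shift _ hR) (disj_shift _ hdisj) (ruleD_shift _ hrule) (effOut_shift _ hout)
    (a1_shiftD _ D h1)

/-- **VACUITY OF THE BUDGET-FREE v4.1 CLAUSES WITH EFFECTIVE HALL-OUT ON RING 2, EVERY HEIGHT.** -/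
theorem ring2_vacuous_allHeights {h : ℤ} {D : Design} (hD : D.OnAlphabet h) (hR : Ring2 D) (hdisj : Disj D) (hrule : RuleD D)
    (hout : EffOut D) (h1 : D.A1) (hμ : D.mu ≠ 0) : False :=
  hμ (ring2_mu_eq_zero_allHeights hD hR hdisj hrule hout h1)

end Summit.HodgeConjecture.HodgeConjecture.Cruxes.BlochSeedDiscOne.RingTwoEffEmpty
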